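import Literature.NumberTheory.LFunctions.NotAlmostMonomialSL25
import Literature.NumberTheory.LFunctions.NotAlmostMonomialGL23
import HarnessLib

/-!
# Booker 2006, §2 p. 390: `GL₂(𝔽₃)` and `SL₂(𝔽₅)` are not almost monomial — the named fact discharged

Topic `Literature/NumberTheory/LFunctions`; namespace `Literature.NumberTheory.LFunctions`.  Discharge
of the named fact `booker2006_notAlmostMonomial` of `CertifiedArtinHolomorphyCriterion.lean`
(A. R. Booker, *Artin's conjecture, Turing's method, and the Riemann hypothesis*, Experiment. Math.
15 (2006) §2 p. 390, after Proposition 2.3: "With the evidence provided by Propositions 2.2 and 2.3,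
one might hope that all groups are almost monomial. That is not the case, as the counterexamples
`GL₂(𝔽₃)` and `SL₂(𝔽₅)` show"; printed justification: GAP computations, for `SL₂(𝔽₅)` with the
explicit vectors of (2–8), p. 391) as
**`booker2006_notAlmostMonomial_holds : booker2006_notAlmostMonomial`**, the conjunction of
`Booker2006.GL23.not_isAlmostMonomial_GL23` (`NotAlmostMonomialGL23.lean`: `χ₄ = (χ₄ − χ₂) + χ₂`
with `χ₂` faithful of degree `2`) and `Booker2006.SL25.not_isAlmostMonomial_SL25`
(`NotAlmostMonomialSL25.lean`: `χ₆ = (χ₆ − χ₄) + χ₄`, Booker's third printed vector).  Both rest on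
the kernel-certified tables of subgroups up to conjugacy
(`Literature/GroupTheory/{GL23,SL25}SubgroupClasses.lean`, via `SubgroupConjugacyCertificate.lean`),
which replace GAP's enumeration of "all monomial `σ`".  With `booker2006_proposition22_holds`
(`WeakAlmostMonomialArtinHolomorphy.lean`) and `booker2006_proposition23_holds`
(`AlmostMonomialBookerGroups.lean`) every named fact of Booker's §2 typed in
`CertifiedArtinHolomorphyCriterion.lean` is now a theorem.

## References
* [Booker2006] A. R. Booker, *Artin's conjecture, Turing's method, and the Riemann hypothesis*,
  Experiment. Math. 15 (2006) 385–407, §2 p. 390 (journal pdf `paper:url-702ab4eacdaa` p. 6;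
  arXiv math/0507502 p. 8).
-/

namespace Literature.NumberTheory.LFunctions

/-- **Booker 2006, §2 p. 390 (the named fact `booker2006_notAlmostMonomial`, discharged):**
`GL₂(𝔽₃)` and `SL₂(𝔽₅)` are not almost monomial. [cite: Booker2006, §2 p. 390] -/
theorem booker2006_notAlmostMonomial_holds : booker2006_notAlmostMonomial :=
  ⟨Booker2006.GL23.not_isAlmostMonomial_GL23, Booker2006.SL25.not_isAlmostMonomial_SL25⟩

end Literature.NumberTheory.LFunctions
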